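import Mathlib
import Literature.Analysis.ODE.HolomorphicLinearODEStarConvex

/-!
# Route `FilamentSkeletonRss` · twin child cruxes `TangentSkeletonNearStraight` (stmt-28295) / `TangentSkeletonNearStraightL` (stmt-23320) ·
# shared registered stub `stub_stripPropagation : StripPropagation` — brick: CAUCHY'S THEOREM FOR STRAIGHT SEGMENTS (sloped source contours)

The quarter-width programme for the shared stub P2 (hands leafhand-15, evidence `CORNER-QUARTER-BLUEPRINT-leafhand-15-g0.md` on 23320) puts
own-filament SOURCES on a TARGET-DEPENDENT polygonal contour with SLOPED descents (`ζ(f) = (x₀ + hs/5 + (3hs/10)f) + i·Y(1−f)`,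
`Theorems.StadiumCornerRightNear`), whereas the landed sixteenth-width build moves only between HORIZONTAL plateaus joined by VERTICAL
connectors (`Theorems.StadiumShiftedContour`, `Theorems.StadiumContourFamily.plateau_connectors_eq` — Mathlib's rectangle Cauchy theorem).
Freezing / deforming a contour with sloped pieces needs Cauchy's theorem for straight SEGMENTS of arbitrary direction, which Mathlib does not
state; it does give primitives of holomorphic functions on discs (`DifferentiableOn.isExactOn_ball`, Morera).  This file turns that into the
segment calculus a polygonal source contour needs, for kernels with values in any complete complex normed space (`ℂ`, `Fin 3 → ℂ`):

* §1 `segmentIntegral_eq_sub_of_hasDerivAt` — the straight-segment integral `∫₀¹ (q − p) • f(p + t(q − p)) dt` of a continuous `f` with a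
  primitive `g` along the segment is `g q − g p` (chain rule + FTC; the path derivative is `Literature.Analysis.ODE.hasDerivAt_complexRay`);
* §2 `segmentIntegral_triangle_ball`, `segmentIntegral_two_paths_ball`, `segmentIntegral_split_ball` — closed triangles / two two-segment paths with
  common endpoints / subdivision, for `f` holomorphic on a disc containing the vertices (convexity of the disc);
* §3 `segmentIntegral_reverse` (orientation), `segmentIntegral_horizontal`, `segmentIntegral_vertical` — the dictionary with the tree's
  `∫ σ in a..b, K(σ + y·I)` and `I • ∫ s in y₀..y₁, K(x + s·I)` pieces (pure substitution, no holomorphy);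
The ε-TUBE DEFORMATION of a whole sloped segment (`[p,q] + [q,q'] = [p,p'] + [p',q']` when `f` is holomorphic on the `δ`-discs about the segment
and `p', q'` are `δ/2`-close — the sloped analogue of `plateau_connectors_eq`) is the sequel file `Theorems.StadiumSegmentTube`, by subdivision into
rungs each inside one disc of §2.

HONEST FRAMING: complex-analysis bricks for the bookkeeping of a HYPOTHETICAL filament skeleton on the NEGATIVE side of a MODEL route; no stub of
28295 / 23320 is closed here; nothing here bears on Navier–Stokes regularity or blow-up.  `--supports stmt-NavierStokesRegularity-28295`.
-/

set_option linter.dupNamespace false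

noncomputable section

namespace Summit.NavierStokesRegularity.NavierStokesRegularity.Theorems.StadiumSegmentCauchy

open Set Metric MeasureTheory Complex

variable {E : Type*} [NormedAddCommGroup E] [NormedSpace ℝ E] [NormedSpace ℂ E] [IsScalarTower ℝ ℂ E] [CompleteSpace E]

/-! ## §1  The straight-segment integral and the fundamental theorem of calculus along it -/

/-- The affine parametrisation is continuous. [folklore] -/
theorem continuous_affinePath (p q : ℂ) : Continuous (fun s : ℝ => p + (s : ℂ) * (q - p)) :=
  continuous_const.add (continuous_ofReal.mul continuous_const)

/-- Endpoints of the affine parametrisation. [folklore] -/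
theorem affinePath_zero (p q : ℂ) : p + ((0 : ℝ) : ℂ) * (q - p) = p := by simp

/-- Endpoints of the affine parametrisation. [folklore] -/
theorem affinePath_one (p q : ℂ) : p + ((1 : ℝ) : ℂ) * (q - p) = q := by simp

/-- **FTC along a straight segment.**  If `g` has complex derivative `f z` at every point `z` of a set `U` on which `f` is continuous, and the
segment `{p + t(q − p) : t ∈ [0,1]}` lies in `U`, then `∫₀¹ (q − p) • f(p + t(q − p)) dt = g q − g p`. [folklore] -/
theorem segmentIntegral_eq_sub_of_hasDerivAt {U : Set ℂ} {f g : ℂ → E} {p q : ℂ}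
    (hg : ∀ z ∈ U, HasDerivAt g (f z) z) (hf : ContinuousOn f U)
    (hseg : ∀ t ∈ Icc (0:ℝ) 1, p + (t : ℂ) * (q - p) ∈ U) :
    ∫ t in (0:ℝ)..1, (q - p) • f (p + (t : ℂ) * (q - p)) = g q - g p := by
  have hderiv : ∀ t ∈ uIcc (0:ℝ) 1, HasDerivAt (fun s : ℝ => g (p + (s : ℂ) * (q - p)))
      ((q - p) • f (p + (t : ℂ) * (q - p))) t := by
    intro t ht
    rw [uIcc_of_le zero_le_one] at ht
    exact (hg _ (hseg t ht)).scomp t (Literature.Analysis.ODE.hasDerivAt_complexRay p q t)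
  have hcont : ContinuousOn (fun t : ℝ => (q - p) • f (p + (t : ℂ) * (q - p))) (uIcc (0:ℝ) 1) := by
    rw [uIcc_of_le zero_le_one]
    exact continuousOn_const.smul (hf.comp (continuous_affinePath p q).continuousOn fun t ht => hseg t ht)
  rw [intervalIntegral.integral_eq_sub_of_hasDerivAt hderiv (hcont.intervalIntegrable)]
  simp

/-! ## §2  Cauchy's theorem for segments inside a disc -/

/-- A disc is convex: the segment between two of its points stays inside. [folklore] -/
theorem affinePath_mem_ball {c p q : ℂ} {r : ℝ} (hp : p ∈ ball c r) (hq : q ∈ ball c r)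
    {t : ℝ} (ht : t ∈ Icc (0:ℝ) 1) : p + (t : ℂ) * (q - p) ∈ ball c r := by
  have h := (convex_ball c r).add_smul_sub_mem hp hq ht
  simpa [Complex.real_smul] using h

/-- **Segment integral = primitive difference in a disc.**  For `f` holomorphic on a disc and `p, q` in the disc, with `g` ANY primitive of `f` on the
disc (Mathlib's `DifferentiableOn.isExactOn_ball` provides one), `∫₀¹ (q − p) • f(p + t(q − p)) dt = g q − g p`. [folklore; Morera/Cauchy on a disc] -/
theorem segmentIntegral_eq_sub_ball {c p q : ℂ} {r : ℝ} {f g : ℂ → E}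
    (hf : DifferentiableOn ℂ f (ball c r)) (hg : ∀ z ∈ ball c r, HasDerivAt g (f z) z)
    (hp : p ∈ ball c r) (hq : q ∈ ball c r) :
    ∫ t in (0:ℝ)..1, (q - p) • f (p + (t : ℂ) * (q - p)) = g q - g p :=
  segmentIntegral_eq_sub_of_hasDerivAt hg hf.continuousOn fun _ ht => affinePath_mem_ball hp hq ht

/-- **Cauchy's theorem for a triangle in a disc.**  For `f` holomorphic on a disc containing `p, q, w`, the three segment integrals around the
triangle sum to zero. [folklore] -/
theorem segmentIntegral_triangle_ball {c p q w : ℂ} {r : ℝ} {f : ℂ → E}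
    (hf : DifferentiableOn ℂ f (ball c r)) (hp : p ∈ ball c r) (hq : q ∈ ball c r) (hw : w ∈ ball c r) :
    (∫ t in (0:ℝ)..1, (q - p) • f (p + (t : ℂ) * (q - p))) +
      (∫ t in (0:ℝ)..1, (w - q) • f (q + (t : ℂ) * (w - q))) +
      (∫ t in (0:ℝ)..1, (p - w) • f (w + (t : ℂ) * (p - w))) = 0 := by
  obtain ⟨g, hg⟩ := hf.isExactOn_ball
  rw [segmentIntegral_eq_sub_ball hf hg hp hq, segmentIntegral_eq_sub_ball hf hg hq hw,
    segmentIntegral_eq_sub_ball hf hg hw hp]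
  abel

/-- **Two polygonal paths with common endpoints in a disc.**  For `f` holomorphic on a disc containing `p, q, v, w`:
`[p,q] + [q,w] = [p,v] + [v,w]` as segment integrals. [folklore] -/
theorem segmentIntegral_two_paths_ball {c p q v w : ℂ} {r : ℝ} {f : ℂ → E}
    (hf : DifferentiableOn ℂ f (ball c r)) (hp : p ∈ ball c r) (hq : q ∈ ball c r) (hv : v ∈ ball c r)
    (hw : w ∈ ball c r) :
    (∫ t in (0:ℝ)..1, (q - p) • f (p + (t : ℂ) * (q - p))) + (∫ t in (0:ℝ)..1, (w - q) • f (q + (t : ℂ) * (w - q))) =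
      (∫ t in (0:ℝ)..1, (v - p) • f (p + (t : ℂ) * (v - p))) + (∫ t in (0:ℝ)..1, (w - v) • f (v + (t : ℂ) * (w - v))) := by
  obtain ⟨g, hg⟩ := hf.isExactOn_ball
  rw [segmentIntegral_eq_sub_ball hf hg hp hq, segmentIntegral_eq_sub_ball hf hg hq hw,
    segmentIntegral_eq_sub_ball hf hg hp hv, segmentIntegral_eq_sub_ball hf hg hv hw]
  abel

/-- **Subdivision in a disc.**  For `f` holomorphic on a disc containing `p, q` and any `m` in the disc (typically on the segment):
`[p,q] = [p,m] + [m,q]`. [folklore] -/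
theorem segmentIntegral_split_ball {c p q m : ℂ} {r : ℝ} {f : ℂ → E}
    (hf : DifferentiableOn ℂ f (ball c r)) (hp : p ∈ ball c r) (hq : q ∈ ball c r) (hm : m ∈ ball c r) :
    ∫ t in (0:ℝ)..1, (q - p) • f (p + (t : ℂ) * (q - p)) =
      (∫ t in (0:ℝ)..1, (m - p) • f (p + (t : ℂ) * (m - p))) + (∫ t in (0:ℝ)..1, (q - m) • f (m + (t : ℂ) * (q - m))) := by
  obtain ⟨g, hg⟩ := hf.isExactOn_ball
  rw [segmentIntegral_eq_sub_ball hf hg hp hq, segmentIntegral_eq_sub_ball hf hg hp hm,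
    segmentIntegral_eq_sub_ball hf hg hm hq]
  abel

/-! ## §3  Orientation and the dictionary with horizontal / vertical pieces (pure substitution) -/

omit [CompleteSpace E] in
/-- **Orientation.**  Reversing a segment negates its integral (no holomorphy needed). [folklore] -/
theorem segmentIntegral_reverse (f : ℂ → E) (p q : ℂ) :
    ∫ t in (0:ℝ)..1, (p - q) • f (q + (t : ℂ) * (p - q)) = -∫ t in (0:ℝ)..1, (q - p) • f (p + (t : ℂ) * (q - p)) := by
  have hsub : (fun t : ℝ => (p - q) • f (q + (t : ℂ) * (p - q))) =
      fun t : ℝ => (fun s : ℝ => (p - q) • f (p + (s : ℂ) * (q - p))) (1 - t) := by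
    funext t
    simp only [Complex.ofReal_sub, Complex.ofReal_one]
    congr 2
    ring
  rw [hsub, intervalIntegral.integral_comp_sub_left (fun s : ℝ => (p - q) • f (p + (s : ℂ) * (q - p))) (1:ℝ)]
  simp only [sub_self, sub_zero, intervalIntegral.integral_smul]
  rw [← neg_smul, neg_sub]

omit [CompleteSpace E] in
/-- **Horizontal segments.**  `[a + iy, b + iy] = ∫ σ in a..b, f(σ + iy) dσ`. [folklore] -/
theorem segmentIntegral_horizontal (f : ℂ → E) (a b y : ℝ) :
    ∫ t in (0:ℝ)..1, (((b : ℂ) + (y : ℂ) * I) - ((a : ℂ) + (y : ℂ) * I)) •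
        f (((a : ℂ) + (y : ℂ) * I) + (t : ℂ) * (((b : ℂ) + (y : ℂ) * I) - ((a : ℂ) + (y : ℂ) * I))) =
      ∫ σ in a..b, f ((σ : ℂ) + (y : ℂ) * I) := by
  have hpt : ∀ t : ℝ, ((a : ℂ) + (y : ℂ) * I) + (t : ℂ) * (((b : ℂ) + (y : ℂ) * I) - ((a : ℂ) + (y : ℂ) * I)) =
      (((b - a) * t + a : ℝ) : ℂ) + (y : ℂ) * I := by
    intro t; push_cast; ring
  have hdir : ((b : ℂ) + (y : ℂ) * I) - ((a : ℂ) + (y : ℂ) * I) = ((b - a : ℝ) : ℂ) := by push_cast; ring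
  have key : ∀ (r : ℝ) (v : E), (r : ℂ) • v = r • v := fun r v => by
    rw [show ((r : ℂ)) = r • (1:ℂ) by rw [Complex.real_smul, mul_one], smul_assoc, one_smul]
  simp_rw [hpt, hdir, key]
  rw [intervalIntegral.integral_smul,
    intervalIntegral.smul_integral_comp_mul_add (fun σ : ℝ => f ((σ : ℂ) + (y : ℂ) * I)) (b - a) a]
  simp

omit [CompleteSpace E] in
/-- **Vertical segments.**  `[x + iy₀, x + iy₁] = I • ∫ s in y₀..y₁, f(x + is) ds`. [folklore] -/
theorem segmentIntegral_vertical (f : ℂ → E) (x y₀ y₁ : ℝ) :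
    ∫ t in (0:ℝ)..1, (((x : ℂ) + (y₁ : ℂ) * I) - ((x : ℂ) + (y₀ : ℂ) * I)) •
        f (((x : ℂ) + (y₀ : ℂ) * I) + (t : ℂ) * (((x : ℂ) + (y₁ : ℂ) * I) - ((x : ℂ) + (y₀ : ℂ) * I))) =
      I • ∫ s in y₀..y₁, f ((x : ℂ) + (s : ℂ) * I) := by
  have hpt : ∀ t : ℝ, ((x : ℂ) + (y₀ : ℂ) * I) + (t : ℂ) * (((x : ℂ) + (y₁ : ℂ) * I) - ((x : ℂ) + (y₀ : ℂ) * I)) =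
      (x : ℂ) + (((y₁ - y₀) * t + y₀ : ℝ) : ℂ) * I := by
    intro t; push_cast; ring
  have hdir : ((x : ℂ) + (y₁ : ℂ) * I) - ((x : ℂ) + (y₀ : ℂ) * I) = I * (((y₁ - y₀ : ℝ) : ℂ)) := by push_cast; ring
  have key : ∀ (r : ℝ) (v : E), (r : ℂ) • v = r • v := fun r v => by
    rw [show ((r : ℂ)) = r • (1:ℂ) by rw [Complex.real_smul, mul_one], smul_assoc, one_smul]
  simp_rw [hpt, hdir, mul_smul, key]
  rw [intervalIntegral.integral_smul, intervalIntegral.integral_smul,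
    intervalIntegral.smul_integral_comp_mul_add (fun s : ℝ => f ((x : ℂ) + (s : ℂ) * I)) (y₁ - y₀) y₀]
  simp

end Summit.NavierStokesRegularity.NavierStokesRegularity.Theorems.StadiumSegmentCauchy
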